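import Literature.Computability.Complexity.Hastad3SatSmooth
import Literature.Computability.Complexity.ProjectionGames
import HarnessLib

/-!
# Håstad's 3-SAT test on a smooth projection game: completeness and soundness (Thm 6.5, game level)

Håstad, *Some optimal inapproximability results*, J. ACM 48 (2001), §6.1, assembled over a weighted
projection game `G : ProjGame E V U β α` (`ProjectionGames.lean`; Bob = the projected side `W`,
Alice = the side `U`).  The written proof consists of a folded Boolean long-code table `A u` on
`{0,1}^α` for every vertex `u` of Alice and a folded table `B v` on `{0,1}^{Lab v}` for every vertex
`v` of Bob, where `Lab v ⊆ β` is the set of labels of `v` on which every projection at `v` is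
defined (Håstad's conditioning upon the clauses of `W`: the long code on the projected side ranges
over satisfying assignments only).  The verifier picks an edge `e` with probability `w_e / total` and
runs Test `3S^ε` (`Hastad3SatTest.lean`) on `(A (dst e), B (src e))` through the projection of `e`;
its acceptance probability is `testAcc`.  PROVED here:

* `testAcc_longCode` — **completeness** (Lemma 6.6 / 6.12): if deterministic strategies `b, a`
  satisfy every edge, the long codes of `b v` and `a u` are accepted with probability `1`;
* `fracVal`, `fracVal_le_of_valLe` — randomized strategies given by sub-probability vectors on the
  labels are no better than deterministic ones (vertex-wise maximisation, as in
  `ProjGame.normG_le_of_valLe`);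
* `fracVal_decode_ge` — Håstad's decoding ("`P₁` chooses `β` with probability `B̂_β²` and a random
  `y ∈ β`, `P₂` chooses `α` with probability `Â_α²` and a random `x ∈ α`", p. 47) succeeds with
  probability at least `E_v Q_v` (eq. (43); `decodeQ` of `Hastad3SatSmooth.lean`);
* `testAcc_soundness` — **soundness** (Lemmas 6.7, 6.11, 6.13 via `smooth_vertex_soundness`): if
  `val(G) ≤ θ` and the edges at every vertex of Bob form a `(T, ξ)`-smooth family of projections,
  then for all folded tables
  `testAcc ≤ 7/8 + (ε + e^{-Tε/4} + e^{-Tε/8} + 2ξ + √(T θ)) / 8`.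

With `ε, ξ, e^{-Tε/8} ≤ δ` and `θ < δ²/T` this is `< 7/8 + δ`… precisely: acceptance probability
`≥ 7/8 + δ` forces `√(Tθ) ≥ 8δ - (ε + e^{-Tε/4} + e^{-Tε/8} + 2ξ)`, Håstad's Lemma 6.13 with the
soundness of the two-prover game made explicit.  The smoothness hypothesis replaces Håstad's
Lemma 6.9 (see the module docstring of `Hastad3SatSmooth.lean`); it is supplied by the smoothed
parallel repetition of later files.

## References

* J. Håstad, *Some optimal inapproximability results*, J. ACM 48 (2001) 798–859, §6.1 (Test 3S,
  Lemmas 6.6, 6.7, 6.11–6.13, proof of Thm 6.5) [Hastad2001].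
* I. Dinur, D. Steurer, *Analytical approach to parallel repetition*, STOC 2014, §2.1 (projection
  games; the format `ProjGame`) [DinurSteurer2014].
-/

noncomputable section

namespace Literature.Computability.Complexity

namespace ProjGame

open Finset Literature.Probability.RandomGraphs.LowDegree Literature.Computability.Complexity.LongCode
  Literature.Computability.Complexity.Hastad3Sat

variable {E V U β α : Type} (G : ProjGame E V U β α)

/-! ### Admissible labels, edges at a vertex, total projections -/

/-- A label `y` of Bob is **admissible** at `v` if every edge at `v` projects it to some label of
Alice (for the clause–variable game: `y` satisfies the clauses of `W`).
[cite: Hastad2001, §2.6 (conditioning, Def. 2.33)] -/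
def Adm (v : V) (y : β) : Prop := ∀ e, G.src e = v → (G.proj e y).isSome = true

/-- Admissibility is decidable. [folklore] -/
instance instDecidablePredAdm [Fintype E] [DecidableEq V] (v : V) : DecidablePred (G.Adm v) :=
  fun y => inferInstanceAs (Decidable (∀ e, G.src e = v → (G.proj e y).isSome = true))

/-- The label set `Lab v` of Bob's vertex `v` for Håstad's test: the admissible labels (a subtype
of `β`). [cite: Hastad2001, §2.6 (long code conditioned upon h)] -/
abbrev Lab (v : V) : Type := {y : β // G.Adm v y}

/-- The edges at Bob's vertex `v` (the choices `U ⊆ W` of Håstad's verifier at a fixed `W`).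
[cite: Hastad2001, §6.1 (Test 3S, step 1)] -/
abbrev EdgeAt (v : V) : Type := {e : E // G.src e = v}

/-- The projection of an edge at `v` as a TOTAL map on the admissible labels.
[cite: Hastad2001, §6.1 (the projection y ↦ y|_U)] -/
def tproj (v : V) (e : G.EdgeAt v) (y : G.Lab v) : α := (G.proj e.1 y.1).get (y.2 e.1 e.2)

/-- `proj e y = some (tproj v e y)` on admissible labels. [folklore] -/
theorem proj_eq_some_tproj (v : V) (e : G.EdgeAt v) (y : G.Lab v) :
    G.proj e.1 y.1 = some (G.tproj v e y) := by
  simp [tproj]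

/-- The conditional distribution of the edges at `v`: `w_e / wV v`. [cite: DinurSteurer2014, §2.1] -/
def wAt [Fintype E] [DecidableEq V] (v : V) (e : G.EdgeAt v) : ℝ := G.wt e.1 / G.wV v

/-- `wAt v e ≥ 0`. [folklore] -/
theorem wAt_nonneg [Fintype E] [DecidableEq V] (v : V) (e : G.EdgeAt v) : 0 ≤ G.wAt v e :=
  div_nonneg (G.wt_nonneg _) (G.wV_pos v).le

/-- A sum over the edges at `v` as a sum over all edges. [folklore] -/
theorem sum_edgeAt [Fintype E] [DecidableEq V] (v : V) (F : E → ℝ) :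
    ∑ e : G.EdgeAt v, F e.1 = ∑ e, if G.src e = v then F e else 0 := by
  rw [← sum_subtype (univ.filter fun e => G.src e = v) (fun e => by simp) F, sum_filter]

/-- `∑_{e at v} w_e = wV v`. [folklore] -/
theorem sum_wt_edgeAt [Fintype E] [DecidableEq V] (v : V) : ∑ e : G.EdgeAt v, G.wt e.1 = G.wV v := by
  rw [G.sum_edgeAt v G.wt]
  rfl

/-- The conditional weights sum to one. [folklore] -/
theorem sum_wAt [Fintype E] [DecidableEq V] (v : V) : ∑ e : G.EdgeAt v, G.wAt v e = 1 := by
  unfold wAt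
  rw [← sum_div, sum_wt_edgeAt, div_self (G.wV_pos v).ne']

/-! ### The acceptance probability of Håstad's test on the game -/

/-- The acceptance probability of Test `3S^ε` at Bob's vertex `v`: average over the edges at `v`.
[cite: Hastad2001, §6.1 (Test 3S)] -/
def vertexAcc [Fintype E] [DecidableEq V] [Fintype β] [DecidableEq β] [Fintype α] [DecidableEq α]
    (ε : ℝ) (A : U → (α → Bool) → Bool) (B : ∀ v, (G.Lab v → Bool) → Bool) (v : V) : ℝ :=
  ∑ e : G.EdgeAt v, G.wAt v e * accProb ε (G.tproj v e) (A (G.dst e.1)) (B v)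

/-- **The acceptance probability of Håstad's 3-SAT test on the game**: pick an edge with probability
`w_e / total` (equivalently `v` with probability `wV v / total`, then an edge at `v`) and run `3S^ε`.
[cite: Hastad2001, §6.1 (Test 3S)] -/
def testAcc [Fintype E] [Fintype V] [DecidableEq V] [Fintype β] [DecidableEq β] [Fintype α]
    [DecidableEq α] (ε : ℝ) (A : U → (α → Bool) → Bool) (B : ∀ v, (G.Lab v → Bool) → Bool) : ℝ :=
  ∑ v, G.wV v / G.total * G.vertexAcc ε A B v

/-- The game is **`(T, ξ)`-smooth** if at every vertex of Bob the projections of the edges, with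
their conditional weights, form a `(T, ξ)`-smooth family on the admissible labels
(`Hastad3Sat.Smooth`). [cite: Hastad2001, §6.1 (role of Lemma 6.9)] -/
def SmoothAt [Fintype E] [DecidableEq E] [DecidableEq V] (T : ℕ) (ξ : ℝ) : Prop :=
  ∀ v, Hastad3Sat.Smooth (G.wAt v) (G.tproj v) T ξ

/-! ### Completeness -/

/-- Strategies satisfying every edge are admissible everywhere. [folklore] -/
theorem adm_of_sat {b : V → β} {a : U → α} (hsat : ∀ e, G.proj e (b (G.src e)) = some (a (G.dst e)))
    (v : V) : G.Adm v (b v) := fun e he => by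
  rw [← he, hsat e]
  rfl

/-- On an edge at `v`, the total projection of the satisfying label is Alice's label. [folklore] -/
theorem tproj_sat {b : V → β} {a : U → α} (hsat : ∀ e, G.proj e (b (G.src e)) = some (a (G.dst e)))
    (v : V) (e : G.EdgeAt v) : G.tproj v e ⟨b v, G.adm_of_sat hsat v⟩ = a (G.dst e.1) := by
  have h1 := G.proj_eq_some_tproj v e ⟨b v, G.adm_of_sat hsat v⟩
  have h2 := hsat e.1
  rw [e.2] at h2
  simp only at h1
  rw [h1] at h2
  exact Option.some_injective _ h2

/-- **Completeness** (Håstad 2001, Lemmas 6.6 and 6.12): if `b, a` satisfy every edge, the long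
codes `A u = (f ↦ f (a u))`, `B v = (g ↦ g (b v))` pass the test with probability `1`.
[cite: Hastad2001, Lemma 6.12] -/
theorem testAcc_longCode [Fintype E] [Fintype V] [DecidableEq V] [Fintype β] [DecidableEq β]
    [Fintype α] [DecidableEq α] [Nonempty E] (ε : ℝ) {b : V → β} {a : U → α}
    (hsat : ∀ e, G.proj e (b (G.src e)) = some (a (G.dst e))) :
    G.testAcc ε (fun u f => f (a u)) (fun v g => g ⟨b v, G.adm_of_sat hsat v⟩) = 1 := by
  have hv : ∀ v, G.vertexAcc ε (fun u f => f (a u)) (fun v g => g ⟨b v, G.adm_of_sat hsat v⟩) v = 1 := by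
    intro v
    unfold vertexAcc
    have he : ∀ e : G.EdgeAt v, accProb ε (G.tproj v e) (fun f : α → Bool => f (a (G.dst e.1)))
        (fun g : G.Lab v → Bool => g ⟨b v, G.adm_of_sat hsat v⟩) = 1 := by
      intro e
      rw [← G.tproj_sat hsat v e]
      exact accProb_longCode ε (G.tproj v e) _
    rw [sum_congr rfl fun e _ => by rw [he e, mul_one]]
    exact G.sum_wAt v
  unfold testAcc
  rw [sum_congr rfl fun v _ => by rw [hv v, mul_one]]
  exact G.sum_wV_div_total

/-! ### Randomized strategies are no better than deterministic ones -/

/-- The expected weight satisfied by independent randomized strategies: Bob plays `y ∈ Lab v`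
with (sub-)probability `p v y`, Alice plays `x` with (sub-)probability `q u x`.
[cite: Hastad2001, §6.1 (eq. (43))] -/
def fracVal [Fintype E] [Fintype V] [DecidableEq V] [Fintype β] (p : ∀ v, G.Lab v → ℝ)
    (q : U → α → ℝ) : ℝ :=
  ∑ v, ∑ e : G.EdgeAt v, G.wt e.1 * ∑ y : G.Lab v, p v y * q (G.dst e.1) (G.tproj v e y)

/-- Alice's side of the derandomization: for a fixed deterministic `b`, a sub-probability `q` of
Alice satisfies at most what her best deterministic reply does.
[cite: DinurSteurer2014, Claim 2.3 (proof)] -/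
theorem sum_wt_q_le_satW [Fintype E] [Fintype U] [Fintype α] [DecidableEq U] [DecidableEq α]
    {θ : ℝ} (hθ : 0 ≤ θ) (hval : G.ValLe θ) (b : V → β) {q : U → α → ℝ}
    (hq : ∀ u x, 0 ≤ q u x) (hq1 : ∀ u, ∑ x, q u x ≤ 1) :
    ∑ e, G.wt e * ∑ x, (if G.proj e (b (G.src e)) = some x then q (G.dst e) x else 0) ≤
      θ * G.total := by
  -- the weight `t u x` of the edges at `u` satisfied when Alice answers `x` (Bob playing `b`)
  obtain ⟨t, ht⟩ : ∃ t : U → α → ℝ, ∀ u x, t u x =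
      ∑ e, if G.dst e = u ∧ G.proj e (b (G.src e)) = some x then G.wt e else 0 := ⟨_, fun _ _ => rfl⟩
  have ht0 : ∀ u x, 0 ≤ t u x := fun u x => by
    rw [ht]
    exact sum_nonneg fun e _ => by split_ifs; exacts [G.wt_nonneg e, le_rfl]
  -- `∑_u ∑_x q u x · [dst e = u ∧ P e x] w_e = w_e ∑_x [P e x] q (dst e) x` for every edge
  have hedge : ∀ e, ∑ u, ∑ x, q u x * (if G.dst e = u ∧ G.proj e (b (G.src e)) = some x then G.wt e else 0) =
      G.wt e * ∑ x, (if G.proj e (b (G.src e)) = some x then q (G.dst e) x else 0) := by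
    intro e
    rw [sum_eq_single (G.dst e) (fun u _ hu => sum_eq_zero fun x _ => by
      rw [if_neg (fun h => hu h.1.symm), mul_zero]) (fun h => (h (mem_univ _)).elim), mul_sum]
    refine sum_congr rfl fun x _ => ?_
    by_cases hP : G.proj e (b (G.src e)) = some x
    · rw [if_pos ⟨rfl, hP⟩, if_pos hP, mul_comm]
    · rw [if_neg (fun h => hP h.2), if_neg hP, mul_zero, mul_zero]
  have hre : ∑ e, G.wt e * ∑ x, (if G.proj e (b (G.src e)) = some x then q (G.dst e) x else 0) =
      ∑ u, ∑ x, q u x * t u x := by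
    rw [sum_congr rfl fun e _ => (hedge e).symm, sum_comm]
    refine sum_congr rfl fun u _ => ?_
    rw [sum_comm]
    refine sum_congr rfl fun x _ => ?_
    rw [ht u x, mul_sum]
  rw [hre]
  cases isEmpty_or_nonempty α with
  | inl hα =>
    simp only [univ_eq_empty, sum_empty, sum_const_zero]
    exact mul_nonneg hθ G.total_nonneg
  | inr hα =>
    have hmax : ∀ u, ∃ x₀, ∀ x, t u x ≤ t u x₀ := fun u => by
      obtain ⟨x₀, -, hx₀⟩ := exists_max_image univ (t u) univ_nonempty
      exact ⟨x₀, fun x => hx₀ x (mem_univ x)⟩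
    choose astar hastar using hmax
    -- `∑_u t u (a⋆ u) = satW b a⋆`
    have hsat : ∑ u, t u (astar u) = G.satW b astar := by
      rw [sum_congr rfl fun u _ => ht u (astar u)]
      unfold satW
      rw [sum_comm]
      refine sum_congr rfl fun e _ => ?_
      rw [sum_eq_single (G.dst e) (fun u _ hu => by rw [if_neg (fun h => hu h.1.symm)])
        (fun h => (h (mem_univ _)).elim)]
      by_cases hP : G.proj e (b (G.src e)) = some (astar (G.dst e))
      · rw [if_pos ⟨rfl, hP⟩, if_pos hP]
      · rw [if_neg (fun h => hP h.2), if_neg hP]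
    calc ∑ u, ∑ x, q u x * t u x ≤ ∑ u, ∑ x, q u x * t u (astar u) :=
          sum_le_sum fun u _ => sum_le_sum fun x _ => mul_le_mul_of_nonneg_left (hastar u x) (hq u x)
      _ = ∑ u, (∑ x, q u x) * t u (astar u) := sum_congr rfl fun u _ => by rw [sum_mul]
      _ ≤ ∑ u, 1 * t u (astar u) :=
          sum_le_sum fun u _ => mul_le_mul_of_nonneg_right (hq1 u) (ht0 u _)
      _ = G.satW b astar := by simp_rw [one_mul]; exact hsat
      _ ≤ θ * G.total := hval b astar

/-- **Randomized strategies are no better than deterministic ones**: if `val(G) ≤ θ` then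
`fracVal p q ≤ θ · total` for all nonnegative `p, q` with vertex sums `≤ 1` (vertex-wise
maximisation on Bob's side, then on Alice's side).
[cite: DinurSteurer2014, Claim 2.3 (proof: "randomized strategies …")] -/
theorem fracVal_le_of_valLe [Fintype E] [Fintype V] [Fintype U] [Fintype β] [Fintype α]
    [DecidableEq V] [DecidableEq U] [DecidableEq α] {θ : ℝ} (hθ : 0 ≤ θ) (hval : G.ValLe θ)
    {p : ∀ v, G.Lab v → ℝ} (hp : ∀ v y, 0 ≤ p v y) (hp1 : ∀ v, ∑ y, p v y ≤ 1) {q : U → α → ℝ}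
    (hq : ∀ u x, 0 ≤ q u x) (hq1 : ∀ u, ∑ x, q u x ≤ 1) : G.fracVal p q ≤ θ * G.total := by
  classical
  -- Bob's options at `v`: `s v y = ∑_{e at v} w_e q(dst e, π_e y)`
  set s : ∀ v, G.Lab v → ℝ := fun v y => ∑ e : G.EdgeAt v, G.wt e.1 * q (G.dst e.1) (G.tproj v e y)
    with hs
  have hfv : G.fracVal p q = ∑ v, ∑ y : G.Lab v, p v y * s v y := by
    unfold fracVal
    refine sum_congr rfl fun v _ => ?_
    simp_rw [hs, mul_sum]
    rw [sum_comm]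
    refine sum_congr rfl fun y _ => sum_congr rfl fun e _ => ?_
    ring
  -- the weight satisfied at `v` by a general label `y : β` against `q`
  set s' : V → β → ℝ := fun v y => ∑ e : G.EdgeAt v, G.wt e.1 *
    ∑ x, (if G.proj e.1 y = some x then q (G.dst e.1) x else 0) with hs'
  have hs'0 : ∀ v y, 0 ≤ s' v y := fun v y => sum_nonneg fun e _ => mul_nonneg (G.wt_nonneg _)
    (sum_nonneg fun x _ => by split_ifs; exacts [hq _ _, le_rfl])
  have hss' : ∀ v (y : G.Lab v), s v y = s' v y.1 := by
    intro v y
    simp only [hs, hs']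
    refine sum_congr rfl fun e _ => ?_
    congr 1
    rw [G.proj_eq_some_tproj v e y]
    simp only [Option.some.injEq]
    rw [sum_ite_eq univ (G.tproj v e y), if_pos (mem_univ _)]
  -- regrouping `∑_v ∑_{e at v}` as `∑_e`
  have hreg : ∀ b : V → β, ∑ v, s' v (b v) =
      ∑ e, G.wt e * ∑ x, (if G.proj e (b (G.src e)) = some x then q (G.dst e) x else 0) := by
    intro b
    simp only [hs']
    have h1 : ∀ v, ∑ e : G.EdgeAt v, G.wt e.1 *
        ∑ x, (if G.proj e.1 (b v) = some x then q (G.dst e.1) x else 0) =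
        ∑ e, if G.src e = v then
          G.wt e * ∑ x, (if G.proj e (b (G.src e)) = some x then q (G.dst e) x else 0) else 0 := by
      intro v
      rw [G.sum_edgeAt v fun e => G.wt e * ∑ x, (if G.proj e (b v) = some x then q (G.dst e) x else 0)]
      refine sum_congr rfl fun e _ => ?_
      split_ifs with h
      · rw [h]
      · rfl
    simp_rw [h1]
    rw [sum_comm]
    refine sum_congr rfl fun e _ => ?_
    rw [sum_ite_eq univ (G.src e), if_pos (mem_univ _)]
  cases isEmpty_or_nonempty β with
  | inl hβ =>
    have h0 : G.fracVal p q = 0 := by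
      rw [hfv]
      refine sum_eq_zero fun v _ => ?_
      haveI : IsEmpty (G.Lab v) := ⟨fun y => hβ.false y.1⟩
      simp
    rw [h0]
    exact mul_nonneg hθ G.total_nonneg
  | inr hβ =>
    -- Bob's best admissible label at `v` (or anything if there is none)
    have hbest : ∀ v, ∃ y₀ : β, ∀ y : G.Lab v, s v y ≤ s' v y₀ := by
      intro v
      by_cases hne : Nonempty (G.Lab v)
      · obtain ⟨y₀, -, hy₀⟩ := exists_max_image (univ : Finset (G.Lab v)) (s v) univ_nonempty
        exact ⟨y₀.1, fun y => (hy₀ y (mem_univ y)).trans (le_of_eq (hss' v y₀))⟩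
      · exact ⟨Classical.arbitrary β, fun y => (hne ⟨y⟩).elim⟩
    choose bstar hbstar using hbest
    calc G.fracVal p q = ∑ v, ∑ y : G.Lab v, p v y * s v y := hfv
      _ ≤ ∑ v, ∑ y : G.Lab v, p v y * s' v (bstar v) :=
          sum_le_sum fun v _ => sum_le_sum fun y _ => mul_le_mul_of_nonneg_left (hbstar v y) (hp v y)
      _ = ∑ v, (∑ y : G.Lab v, p v y) * s' v (bstar v) := sum_congr rfl fun v _ => by rw [sum_mul]
      _ ≤ ∑ v, 1 * s' v (bstar v) :=
          sum_le_sum fun v _ => mul_le_mul_of_nonneg_right (hp1 v) (hs'0 v _)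
      _ = ∑ v, s' v (bstar v) := by simp_rw [one_mul]
      _ = _ := hreg bstar
      _ ≤ θ * G.total := G.sum_wt_q_le_satW hθ hval bstar hq hq1

/-! ### Håstad's decoding -/

/-- Bob's decoded mixed strategy at `v`: choose `S` with probability `b̂_v(S)²`, then `y ∈ S`
uniformly; as a sub-probability vector on `Lab v`. [cite: Hastad2001, §6.1 (p. 47, strategy of P₁)] -/
def decodeB [Fintype E] [DecidableEq V] [Fintype β] [DecidableEq β] (B : ∀ v, (G.Lab v → Bool) → Bool)
    (v : V) (y : G.Lab v) : ℝ :=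
  ∑ S : Finset (G.Lab v), if y ∈ S then coeff (fun g => sgn (B v g)) S ^ 2 / S.card else 0

/-- Alice's decoded mixed strategy at `u`: choose `R` with probability `â_u(R)²`, then `x ∈ R`
uniformly. [cite: Hastad2001, §6.1 (p. 47, strategy of P₂)] -/
def decodeA {U' α' : Type} [Fintype α'] [DecidableEq α'] (A : U' → (α' → Bool) → Bool) (u : U')
    (x : α') : ℝ :=
  ∑ R : Finset α', if x ∈ R then coeff (fun f => sgn (A u f)) R ^ 2 / R.card else 0

/-- A set-then-uniform-element distribution with set weights `c(R)²` summing to at most one is a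
sub-probability vector. [folklore] -/
theorem sum_setUniform_le_one {κ : Type} [Fintype κ] [DecidableEq κ] (c : Finset κ → ℝ)
    (hc : ∑ R, c R ^ 2 ≤ 1) :
    ∑ x : κ, ∑ R : Finset κ, (if x ∈ R then c R ^ 2 / R.card else 0) ≤ 1 := by
  rw [sum_comm]
  refine le_trans (sum_le_sum fun R _ => ?_) hc
  rw [← sum_filter]
  have : (univ.filter fun x : κ => x ∈ R) = R := by ext x; simp
  rw [this, sum_const, nsmul_eq_mul]
  rcases R.eq_empty_or_nonempty with rfl | hR
  · simp only [card_empty, Nat.cast_zero, zero_mul]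
    exact sq_nonneg _
  · rw [mul_div_cancel₀ _ (Nat.cast_ne_zero.2 hR.card_pos.ne')]

/-- Nonnegativity of a set-then-uniform-element distribution. [folklore] -/
theorem setUniform_nonneg {κ : Type} [Fintype κ] [DecidableEq κ] (c : Finset κ → ℝ) (x : κ) :
    0 ≤ ∑ R : Finset κ, (if x ∈ R then c R ^ 2 / R.card else 0) :=
  sum_nonneg fun R _ => by split_ifs <;> positivity

/-- The decoded strategy of Bob is a sub-probability vector. [cite: Hastad2001, §6.1 (p. 47)] -/
theorem sum_decodeB_le_one [Fintype E] [DecidableEq V] [Fintype β] [DecidableEq β]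
    (B : ∀ v, (G.Lab v → Bool) → Bool) (v : V) : ∑ y, G.decodeB B v y ≤ 1 :=
  sum_setUniform_le_one _ (sum_coeff_sgn_sq (B v)).le

/-- The decoded strategy of Alice is a sub-probability vector. [cite: Hastad2001, §6.1 (p. 47)] -/
theorem sum_decodeA_le_one {U' α' : Type} [Fintype α'] [DecidableEq α'] (A : U' → (α' → Bool) → Bool)
    (u : U') : ∑ x, decodeA A u x ≤ 1 :=
  sum_setUniform_le_one _ (sum_coeff_sgn_sq (A u)).le

/-- For `R ⊆ π(S)`: at least `|R|` elements of `S` project into `R`.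
[cite: Hastad2001, §6.1 (eq. (43): "this happens with probability at least |β|⁻¹")] -/
theorem card_le_card_filter_of_subset_image {κ α' : Type} [DecidableEq α'] (π : κ → α')
    {S : Finset κ} {R : Finset α'} (hR : R ⊆ S.image π) :
    R.card ≤ (S.filter fun y => π y ∈ R).card := by
  have hsub : R ⊆ (S.filter fun y => π y ∈ R).image π := by
    intro x hx
    obtain ⟨y, hy, rfl⟩ := mem_image.1 (hR hx)
    exact mem_image.2 ⟨y, mem_filter.2 ⟨hy, hx⟩, rfl⟩
  exact (card_le_card hsub).trans card_image_le

/-- **Håstad's eq. (43)**, one projection: for set weights `b(S)²` (Bob), `a(R)²` (Alice) with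
`a(∅) = 0`, the set-then-uniform-element strategies meet through `π : κ → α'` with probability at
least `∑_S ∑_{R ⊆ π(S)} b(S)² a(R)² / |S|`. [cite: Hastad2001, eq. (43)] -/
theorem decode_meet_ge {κ α' : Type} [Fintype κ] [DecidableEq κ] [Fintype α'] [DecidableEq α']
    (π : κ → α') (b : Finset κ → ℝ) (a : Finset α' → ℝ) (ha : a ∅ = 0) :
    ∑ S : Finset κ, ∑ R ∈ (S.image π).powerset, b S ^ 2 * a R ^ 2 / S.card ≤
      ∑ y : κ, (∑ S : Finset κ, if y ∈ S then b S ^ 2 / S.card else 0) *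
        (∑ R : Finset α', if π y ∈ R then a R ^ 2 / R.card else 0) := by
  -- expand the right-hand side as a sum over `(S, R)` of `b² a² /(|S| |R|) · #{y ∈ S | π y ∈ R}`
  have hrhs : ∑ y : κ, (∑ S : Finset κ, if y ∈ S then b S ^ 2 / S.card else 0) *
        (∑ R : Finset α', if π y ∈ R then a R ^ 2 / R.card else 0) =
      ∑ S : Finset κ, ∑ R : Finset α',
        b S ^ 2 / S.card * (a R ^ 2 / R.card) * (S.filter fun y => π y ∈ R).card := by
    calc ∑ y : κ, (∑ S : Finset κ, if y ∈ S then b S ^ 2 / S.card else 0) *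
          (∑ R : Finset α', if π y ∈ R then a R ^ 2 / R.card else 0)
        = ∑ y : κ, ∑ S : Finset κ, ∑ R : Finset α',
            (if y ∈ S then b S ^ 2 / S.card else 0) * (if π y ∈ R then a R ^ 2 / R.card else 0) := by
          refine sum_congr rfl fun y _ => ?_
          rw [sum_mul_sum]
      _ = ∑ S : Finset κ, ∑ R : Finset α', ∑ y : κ,
            (if y ∈ S then b S ^ 2 / S.card else 0) * (if π y ∈ R then a R ^ 2 / R.card else 0) := by
          rw [sum_comm]
          exact sum_congr rfl fun S _ => sum_comm
      _ = _ := by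
          refine sum_congr rfl fun S _ => sum_congr rfl fun R _ => ?_
          have : ∀ y : κ, (if y ∈ S then b S ^ 2 / S.card else 0) * (if π y ∈ R then a R ^ 2 / R.card else 0) =
              if y ∈ S ∧ π y ∈ R then b S ^ 2 / S.card * (a R ^ 2 / R.card) else 0 := by
            intro y
            by_cases h1 : y ∈ S <;> by_cases h2 : π y ∈ R <;> simp [h1, h2]
          rw [sum_congr rfl fun y _ => this y, ← sum_filter]
          have hf : (univ.filter fun y => y ∈ S ∧ π y ∈ R) = S.filter (fun y => π y ∈ R) := by
            ext y; simp
          rw [hf, sum_const, nsmul_eq_mul]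
          ring
  rw [hrhs]
  refine sum_le_sum fun S _ => ?_
  -- keep only `R ⊆ π(S)` on the right
  calc ∑ R ∈ (S.image π).powerset, b S ^ 2 * a R ^ 2 / S.card
      ≤ ∑ R ∈ (S.image π).powerset,
          b S ^ 2 / S.card * (a R ^ 2 / R.card) * (S.filter fun y => π y ∈ R).card := by
        refine sum_le_sum fun R hR => ?_
        rw [mem_powerset] at hR
        rcases R.eq_empty_or_nonempty with rfl | hRne
        · simp [ha]
        · have hRpos : (0 : ℝ) < R.card := by exact_mod_cast hRne.card_pos
          have hcnt : (R.card : ℝ) ≤ (S.filter fun y => π y ∈ R).card := by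
            exact_mod_cast card_le_card_filter_of_subset_image π hR
          rcases S.eq_empty_or_nonempty with rfl | hSne
          · simp
          · have hSpos : (0 : ℝ) < S.card := by exact_mod_cast hSne.card_pos
            calc b S ^ 2 * a R ^ 2 / S.card = b S ^ 2 / S.card * (a R ^ 2 / R.card) * R.card := by
                  field_simp
              _ ≤ b S ^ 2 / S.card * (a R ^ 2 / R.card) * (S.filter fun y => π y ∈ R).card :=
                  mul_le_mul_of_nonneg_left hcnt (by positivity)
    _ ≤ ∑ R, b S ^ 2 / S.card * (a R ^ 2 / R.card) * (S.filter fun y => π y ∈ R).card :=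
        sum_le_univ_sum_of_nonneg fun R => by positivity

/-- **Håstad's eq. (43) on the game**: the decoded strategies satisfy weight at least
`∑_v wV(v) · Q_v` (with `Q_v = decodeQ` at `v`), for folded tables of Alice.
[cite: Hastad2001, eq. (43)] -/
theorem sum_wV_mul_decodeQ_le_fracVal [Fintype E] [Fintype V] [DecidableEq V] [Fintype β]
    [DecidableEq β] [Fintype α] [DecidableEq α] (A : U → (α → Bool) → Bool)
    (hA : ∀ u, IsFolded (A u)) (B : ∀ v, (G.Lab v → Bool) → Bool) :
    ∑ v, G.wV v * decodeQ (G.wAt v) (G.tproj v) (fun e => A (G.dst e.1)) (B v) ≤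
      G.fracVal (G.decodeB B) (decodeA A) := by
  unfold fracVal decodeQ
  refine sum_le_sum fun v _ => ?_
  rw [mul_sum]
  refine sum_le_sum fun e _ => ?_
  unfold wAt
  rw [← mul_assoc, mul_div_cancel₀ _ (G.wV_pos v).ne']
  refine mul_le_mul_of_nonneg_left ?_ (G.wt_nonneg _)
  exact decode_meet_ge (G.tproj v e) (fun S => coeff (fun g => sgn (B v g)) S)
    (fun R => coeff (fun f => sgn (A (G.dst e.1) f)) R)
    (coeff_empty_eq_zero_of_isOdd (hA (G.dst e.1)).isOdd_sgn)

/-- `∑_v μ_v √(z_v) ≤ √(∑_v μ_v z_v)` for a probability vector `μ` and `z ≥ 0` (Cauchy–Schwarz).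
[folklore] -/
theorem sum_mul_sqrt_le_sqrt {ι : Type} (s : Finset ι) {μ z : ι → ℝ} (hμ : ∀ i ∈ s, 0 ≤ μ i)
    (hμ1 : ∑ i ∈ s, μ i = 1) (hz : ∀ i ∈ s, 0 ≤ z i) :
    ∑ i ∈ s, μ i * Real.sqrt (z i) ≤ Real.sqrt (∑ i ∈ s, μ i * z i) := by
  refine Real.le_sqrt_of_sq_le ?_
  have h := sq_sum_mul_le_mul_sum_mul_sq s hμ fun i => Real.sqrt (z i)
  rw [hμ1, one_mul] at h
  refine h.trans (le_of_eq (sum_congr rfl fun i hi => ?_))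
  rw [Real.sq_sqrt (hz i hi)]

/-- **Soundness of Håstad's 3-SAT test on a smooth projection game** (Håstad 2001, Lemmas 6.7, 6.11,
6.13 with the game value explicit; smoothness in place of Lemma 6.9): if `val(G) ≤ θ` and the game is
`(T, ξ)`-smooth, then for all folded tables
`8 (testAcc - 7/8) ≤ ε + e^{-Tε/4} + e^{-Tε/8} + 2ξ + √(T θ)`.
[cite: Hastad2001, Lemma 6.13] -/
theorem testAcc_soundness [Fintype E] [Fintype V] [Fintype U] [Fintype β] [Fintype α]
    [DecidableEq E] [DecidableEq V] [DecidableEq U] [DecidableEq β] [DecidableEq α] [Nonempty E]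
    {ε ξ θ : ℝ} (hε : 0 ≤ ε) (hε' : ε ≤ 1 / 2) (hξ : 0 ≤ ξ) (hθ : 0 ≤ θ) (hval : G.ValLe θ)
    {T : ℕ} (hsm : G.SmoothAt T ξ) {A : U → (α → Bool) → Bool} (hA : ∀ u, IsFolded (A u))
    {B : ∀ v, (G.Lab v → Bool) → Bool} (hB : ∀ v, IsFolded (B v)) :
    8 * (G.testAcc ε A B - 7 / 8) ≤
      ε + Real.exp (-(T * ε) / 4) + Real.exp (-(T * ε) / 8) + 2 * ξ + Real.sqrt (T * θ) := by
  set c := ε + Real.exp (-(T * ε) / 4) + Real.exp (-(T * ε) / 8) + 2 * ξ with hc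
  set Q : V → ℝ := fun v => decodeQ (G.wAt v) (G.tproj v) (fun e => A (G.dst e.1)) (B v) with hQ
  have hQ0 : ∀ v, 0 ≤ Q v := fun v =>
    decodeQ_nonneg (G.wAt_nonneg v) (G.tproj v) (fun e => A (G.dst e.1)) (B v)
  -- the vertex inequality
  have hv : ∀ v, 8 * (G.vertexAcc ε A B v - 7 / 8) ≤ c + Real.sqrt (T * Q v) := fun v =>
    smooth_vertex_soundness hε hε' hξ (G.wAt_nonneg v) (G.sum_wAt v) (hsm v)
      (A := fun e => A (G.dst e.1)) (fun e => hA _) (hB v)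
  -- the measure on Bob's vertices
  have hμ : ∀ v, 0 ≤ G.wV v / G.total := fun v => div_nonneg (G.wV_pos v).le G.total_nonneg
  have hμ1 : ∑ v, G.wV v / G.total = 1 := G.sum_wV_div_total
  -- averaging the vertex inequalities
  have h1 : 8 * (G.testAcc ε A B - 7 / 8) ≤ c + ∑ v, G.wV v / G.total * Real.sqrt (T * Q v) := by
    have e1 : 8 * (G.testAcc ε A B - 7 / 8) = ∑ v, G.wV v / G.total * (8 * (G.vertexAcc ε A B v - 7 / 8)) := by
      unfold testAcc
      have : ∑ v, G.wV v / G.total * (8 * (G.vertexAcc ε A B v - 7 / 8)) =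
          8 * ∑ v, G.wV v / G.total * G.vertexAcc ε A B v - 7 * ∑ v, G.wV v / G.total := by
        rw [mul_sum, mul_sum, ← sum_sub_distrib]
        exact sum_congr rfl fun v _ => by ring
      rw [this, hμ1]
      ring
    rw [e1]
    calc ∑ v, G.wV v / G.total * (8 * (G.vertexAcc ε A B v - 7 / 8))
        ≤ ∑ v, G.wV v / G.total * (c + Real.sqrt (T * Q v)) :=
          sum_le_sum fun v _ => mul_le_mul_of_nonneg_left (hv v) (hμ v)
      _ = c + ∑ v, G.wV v / G.total * Real.sqrt (T * Q v) := by
          simp_rw [mul_add]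
          rw [sum_add_distrib, ← sum_mul, hμ1, one_mul]
  -- Cauchy–Schwarz over the vertices and the value of the game
  have h2 : ∑ v, G.wV v / G.total * Real.sqrt (T * Q v) ≤ Real.sqrt (T * θ) := by
    refine (sum_mul_sqrt_le_sqrt univ (fun v _ => hμ v) hμ1
      (fun v _ => mul_nonneg (Nat.cast_nonneg _) (hQ0 v))).trans (Real.sqrt_le_sqrt ?_)
    have hfrac := G.fracVal_le_of_valLe hθ hval (p := G.decodeB B)
      (fun v y => setUniform_nonneg _ y) (G.sum_decodeB_le_one B) (q := decodeA A)
      (fun u x => setUniform_nonneg _ x) (sum_decodeA_le_one A)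
    have hdec := G.sum_wV_mul_decodeQ_le_fracVal A hA B
    have htot := G.total_pos
    calc ∑ v, G.wV v / G.total * (T * Q v) = T / G.total * ∑ v, G.wV v * Q v := by
          rw [mul_sum]
          exact sum_congr rfl fun v _ => by ring
      _ ≤ T / G.total * (θ * G.total) :=
          mul_le_mul_of_nonneg_left (hdec.trans hfrac) (by positivity)
      _ = T * θ := by field_simp
  linarith

end ProjGame

end Literature.Computability.Complexity

end
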